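/-
Copyright (c) 2026. All rights reserved.
Released under Apache 2.0 license as described in the file LICENSE.
-/
import Literature.NumberTheory.Automorphic.MaximalOrderDiscFiveLattice
import HarnessLib

/-!
# Small representation numbers of the norm form `Q₅ = a² + 2b² + 2c² + d² + ac − ad + 2bc + bd` of the maximal order `O₅` of
# `(−2,−5 ∣ ℚ)`: `r₅(2) = 18`, `r₅(3) = 24`, `r₅(4) = 42`, `r₅(6) = 72`, `r₅(7) = 48`, `r₅(8) = 90` — certified box counts, all equal
# to `6(σ(n) − 5σ(n/5))`

[tag: quaternion_algebra] [tag: quadratic_form] [tag: brandt_matrix]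

Topic `NumberTheory/Automorphic`; THEOREMS ONLY (no definition, no named fact, no instance; net Literature debt `0`).
Lane `lit-hodgefound`, seat p12, gen 45 — fifth file on the definite quaternion order of discriminant `5`.

`MaximalOrderDiscFiveLattice` identified `#{x ∈ O₅ : nrd x = n}` with the number `r₅(n)` of integer solutions of `Q₅ = n` and computed
`r₅(1) = 6`; `MaximalOrderDiscFiveNormsFiveMul` gave `r₅(5ᵃm) = r₅(m)`. Eichler's theory predicts, ONCE `# Cls O₅ = 1` is known
(Voight Ex. 17.10 (a), Thm. 25.4.1), that `r₅(n) = 2w·T(n) = 6·Σ_{d ∣ n, 5 ∤ d} d = 6σ(n) − 30σ(n/5)` (row sums `σ(n)` of `B(n)` for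
`(n, 5) = 1`, LNM 320 II §6 Cor. 1; `B(5ᵃ) = 1`); equivalently the theta series of `O₅` is the Eisenstein series of weight `2` and
level `5`. This file CERTIFIES the first values by enumeration — independently of the class number — after confining the solutions
of `Q₅ = n` to a box (`16Q₅ = 4(2a+c−d)² + 2(4b+2c+d)² + 20c² + 10d²`, so `a² ≤ 6n`, `b² ≤ 3n`, `c² ≤ n`, `d² ≤ 2n`):

* §1 `sixteen_mul_form_eq` (the sum-of-squares identity), `sq_le_of_form_eq` (`a² ≤ 6n ∧ b² ≤ 3n ∧ c² ≤ n ∧ d² ≤ 2n`),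
  **`natCard_form_eq_card_filter_box`** (the count is the box count over `[−B₁,B₁]×[−B₂,B₂]×[−B₃,B₃]×[−B₄,B₄]` whenever
  `6n < (B₁+1)²`, `3n < (B₂+1)²`, `n < (B₃+1)²`, `2n < (B₄+1)²`);
* §2 **`natCard_form_two`** (`18 = 6·3`), **`natCard_form_three`** (`24 = 6·4`), **`natCard_form_four`** (`42 = 6·7`),
  **`natCard_form_six`** (`72 = 6·12`), **`natCard_form_seven`** (`48 = 6·8`), **`natCard_form_eight`** (`90 = 6·15`) — by
  `decide +kernel` on anisotropic boxes of at most `13·9·5·9` points; `sigma_values` (`σ(2..8)`), and for `O₅`: `natCard_reducedNorm_two`, `_three`.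

## Sources

* M. Eichler, LNM 320 (1973), Ch. II §6 Thm. 2 Cor. 1 (row sums `σ(n)` of the Brandt matrices for `(n, D) = 1`), §2.
  [cite: Eichler1973, Ch. II §6 Thm. 2 Cor. 1]
* J. Voight, *Quaternion Algebras*, GTM 288 (2021), Exercise 17.10 ((a) `# Cls O = 1` for discriminant `5`; (b) the quaternary form is
  multiplicative and universal), Thm. 25.1.1 (mass `1/3`), Thm. 25.4.1. [cite: Voight2021, Exercise 17.10; Thm. 25.4.1]

## Scope (honest)

Theorems only. Six individual values by certified enumeration; the closed formula `r₅(n) = 6σ(n) − 30σ(n/5)` for all `n` needs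
`# Cls O₅ = 1` (the norm-Euclidean property, Fitzgerald 2012) and the Hecke theory of the Brandt matrices, neither of which is here.
-/

open Quaternion
open Finset

namespace Literature.NumberTheory.Automorphic.MaxOrderDiscFive

/-! ## §1 The solutions of `Q₅ = n` lie in a box -/

section Box

/-- `16·Q₅(a,b,c,d) = 4(2a + c − d)² + 2(4b + 2c + d)² + 20c² + 10d²` (`16·nrd = 16t² + 32x₁² + 80x₂² + 160x₃²`).
[cite: Voight2021, Exercise 17.10 (b)] -/
theorem sixteen_mul_form_eq (a b c d : ℤ) :
    16 * (a ^ 2 + 2 * b ^ 2 + 2 * c ^ 2 + d ^ 2 + a * c - a * d + 2 * b * c + b * d) =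
      4 * (2 * a + c - d) ^ 2 + 2 * (4 * b + 2 * c + d) ^ 2 + 20 * c ^ 2 + 10 * d ^ 2 := by
  ring

/-- `Q₅(a,b,c,d) = n ⟹ a² ≤ 6n ∧ b² ≤ 3n ∧ c² ≤ n ∧ d² ≤ 2n`. [cite: Voight2021, Exercise 17.10 (b)] -/
theorem sq_le_of_form_eq {a b c d n : ℤ} (h : a ^ 2 + 2 * b ^ 2 + 2 * c ^ 2 + d ^ 2 + a * c - a * d + 2 * b * c + b * d = n) :
    a ^ 2 ≤ 6 * n ∧ b ^ 2 ≤ 3 * n ∧ c ^ 2 ≤ n ∧ d ^ 2 ≤ 2 * n := by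
  have h16 := sixteen_mul_form_eq a b c d
  rw [h] at h16
  have hP : (2 * a + c - d) ^ 2 ≤ 4 * n := by nlinarith [sq_nonneg (4 * b + 2 * c + d), sq_nonneg c, sq_nonneg d]
  have hR : (4 * b + 2 * c + d) ^ 2 ≤ 8 * n := by nlinarith [sq_nonneg (2 * a + c - d), sq_nonneg c, sq_nonneg d]
  have hc : c ^ 2 ≤ n := by nlinarith [sq_nonneg (2 * a + c - d), sq_nonneg (4 * b + 2 * c + d), sq_nonneg d]
  have hd : d ^ 2 ≤ 2 * n := by nlinarith [sq_nonneg (2 * a + c - d), sq_nonneg (4 * b + 2 * c + d), sq_nonneg c]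
  refine ⟨?_, ?_, hc, hd⟩
  · nlinarith [sq_nonneg (2 * a + c - d + c), sq_nonneg (2 * a + c - d - d), sq_nonneg (c + d)]
  · nlinarith [sq_nonneg (4 * b + 2 * c + d + 2 * c), sq_nonneg (4 * b + 2 * c + d + d), sq_nonneg (2 * c - d)]

/-- `x² ≤ m`, `m < (B+1)²`, `0 ≤ B` ⟹ `−B ≤ x ≤ B`. [folklore] -/
private theorem abs_le_of_sq_le {x m B : ℤ} (hB : 0 ≤ B) (hx : x ^ 2 ≤ m) (hm : m < (B + 1) ^ 2) : -B ≤ x ∧ x ≤ B := by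
  have h : x ^ 2 < (B + 1) ^ 2 := lt_of_le_of_lt hx hm
  have habs : |x| < B + 1 := abs_lt_of_sq_lt_sq h (by linarith)
  obtain ⟨h1, h2⟩ := abs_lt.1 habs
  constructor <;> omega

/-- **The representation count is a finite box count:** if `6n < (B₁+1)²`, `3n < (B₂+1)²`, `n < (B₃+1)²`, `2n < (B₄+1)²` then the
solutions of `Q₅ = n` are exactly those in the box `[−B₁,B₁] × [−B₂,B₂] × [−B₃,B₃] × [−B₄,B₄]`. [cite: Voight2021, Exercise 17.10 (b)] -/
theorem natCard_form_eq_card_filter_box (n B₁ B₂ B₃ B₄ : ℤ) (hB₁ : 0 ≤ B₁) (hB₂ : 0 ≤ B₂) (hB₃ : 0 ≤ B₃) (hB₄ : 0 ≤ B₄)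
    (h₁ : 6 * n < (B₁ + 1) ^ 2) (h₂ : 3 * n < (B₂ + 1) ^ 2) (h₃ : n < (B₃ + 1) ^ 2) (h₄ : 2 * n < (B₄ + 1) ^ 2) :
    Nat.card {v : ℤ × ℤ × ℤ × ℤ //
        v.1 ^ 2 + 2 * v.2.1 ^ 2 + 2 * v.2.2.1 ^ 2 + v.2.2.2 ^ 2 + v.1 * v.2.2.1 - v.1 * v.2.2.2 +
          2 * v.2.1 * v.2.2.1 + v.2.1 * v.2.2.2 = n} =
      ((Icc (-B₁) B₁ ×ˢ Icc (-B₂) B₂ ×ˢ Icc (-B₃) B₃ ×ˢ Icc (-B₄) B₄).filter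
        fun v : ℤ × ℤ × ℤ × ℤ => v.1 ^ 2 + 2 * v.2.1 ^ 2 + 2 * v.2.2.1 ^ 2 + v.2.2.2 ^ 2 + v.1 * v.2.2.1 - v.1 * v.2.2.2 +
          2 * v.2.1 * v.2.2.1 + v.2.1 * v.2.2.2 = n).card := by
  have hS : {v : ℤ × ℤ × ℤ × ℤ |
      v.1 ^ 2 + 2 * v.2.1 ^ 2 + 2 * v.2.2.1 ^ 2 + v.2.2.2 ^ 2 + v.1 * v.2.2.1 - v.1 * v.2.2.2 +
        2 * v.2.1 * v.2.2.1 + v.2.1 * v.2.2.2 = n} =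
      ↑((Icc (-B₁) B₁ ×ˢ Icc (-B₂) B₂ ×ˢ Icc (-B₃) B₃ ×ˢ Icc (-B₄) B₄).filter
        fun v : ℤ × ℤ × ℤ × ℤ => v.1 ^ 2 + 2 * v.2.1 ^ 2 + 2 * v.2.2.1 ^ 2 + v.2.2.2 ^ 2 + v.1 * v.2.2.1 - v.1 * v.2.2.2 +
          2 * v.2.1 * v.2.2.1 + v.2.1 * v.2.2.2 = n) := by
    ext ⟨a, b, c, d⟩
    simp only [Set.mem_setOf_eq, coe_filter, mem_Icc, mem_product]
    constructor
    · intro h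
      obtain ⟨ha, hb, hc, hd⟩ := sq_le_of_form_eq h
      exact ⟨⟨abs_le_of_sq_le hB₁ ha h₁, abs_le_of_sq_le hB₂ hb h₂, abs_le_of_sq_le hB₃ hc h₃, abs_le_of_sq_le hB₄ hd h₄⟩, h⟩
    · exact And.right
  rw [← Set.ncard_coe_finset, ← hS]
  exact Nat.card_coe_set_eq _

end Box

/-! ## §2 `r₅(2) = 18`, `r₅(3) = 24`, `r₅(4) = 42`, `r₅(6) = 72`, `r₅(7) = 48`, `r₅(8) = 90` -/

section Counts

/-- **`r₅(2) = 18 = 6σ(2)`.** [cite: Eichler1973, Ch. II §6 Thm. 2 Cor. 1] [cite: Voight2021, Exercise 17.10] -/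
theorem natCard_form_two :
    Nat.card {v : ℤ × ℤ × ℤ × ℤ //
        v.1 ^ 2 + 2 * v.2.1 ^ 2 + 2 * v.2.2.1 ^ 2 + v.2.2.2 ^ 2 + v.1 * v.2.2.1 - v.1 * v.2.2.2 +
          2 * v.2.1 * v.2.2.1 + v.2.1 * v.2.2.2 = 2} = 18 := by
  rw [natCard_form_eq_card_filter_box 2 3 2 1 2 (by norm_num) (by norm_num) (by norm_num) (by norm_num) (by norm_num) (by norm_num)
    (by norm_num) (by norm_num)]
  decide +kernel

/-- **`r₅(3) = 24 = 6σ(3)`.** [cite: Eichler1973, Ch. II §6 Thm. 2 Cor. 1] [cite: Voight2021, Exercise 17.10] -/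
theorem natCard_form_three :
    Nat.card {v : ℤ × ℤ × ℤ × ℤ //
        v.1 ^ 2 + 2 * v.2.1 ^ 2 + 2 * v.2.2.1 ^ 2 + v.2.2.2 ^ 2 + v.1 * v.2.2.1 - v.1 * v.2.2.2 +
          2 * v.2.1 * v.2.2.1 + v.2.1 * v.2.2.2 = 3} = 24 := by
  rw [natCard_form_eq_card_filter_box 3 4 3 1 2 (by norm_num) (by norm_num) (by norm_num) (by norm_num) (by norm_num) (by norm_num)
    (by norm_num) (by norm_num)]
  decide +kernel

/-- **`r₅(4) = 42 = 6σ(4)`** (a non-squarefree value: `T(4) = 7 = T(2)² − 2`, Eichler's recursion at the split prime `2`).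
[cite: Eichler1973, Ch. II §6 Thm. 2 (19) and Cor. 1] -/
theorem natCard_form_four :
    Nat.card {v : ℤ × ℤ × ℤ × ℤ //
        v.1 ^ 2 + 2 * v.2.1 ^ 2 + 2 * v.2.2.1 ^ 2 + v.2.2.2 ^ 2 + v.1 * v.2.2.1 - v.1 * v.2.2.2 +
          2 * v.2.1 * v.2.2.1 + v.2.1 * v.2.2.2 = 4} = 42 := by
  rw [natCard_form_eq_card_filter_box 4 4 3 2 2 (by norm_num) (by norm_num) (by norm_num) (by norm_num) (by norm_num) (by norm_num)
    (by norm_num) (by norm_num)]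
  decide +kernel

/-- **`r₅(6) = 72 = 6σ(6)`** (`= r₅(2)r₅(3)/6`: multiplicativity). [cite: Eichler1973, Ch. II §6 Thm. 2 (18) and Cor. 1] -/
theorem natCard_form_six :
    Nat.card {v : ℤ × ℤ × ℤ × ℤ //
        v.1 ^ 2 + 2 * v.2.1 ^ 2 + 2 * v.2.2.1 ^ 2 + v.2.2.2 ^ 2 + v.1 * v.2.2.1 - v.1 * v.2.2.2 +
          2 * v.2.1 * v.2.2.1 + v.2.1 * v.2.2.2 = 6} = 72 := by
  rw [natCard_form_eq_card_filter_box 6 6 4 2 3 (by norm_num) (by norm_num) (by norm_num) (by norm_num) (by norm_num) (by norm_num)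
    (by norm_num) (by norm_num)]
  decide +kernel

/-- **`r₅(7) = 48 = 6σ(7)`.** [cite: Eichler1973, Ch. II §6 Thm. 2 Cor. 1] -/
theorem natCard_form_seven :
    Nat.card {v : ℤ × ℤ × ℤ × ℤ //
        v.1 ^ 2 + 2 * v.2.1 ^ 2 + 2 * v.2.2.1 ^ 2 + v.2.2.2 ^ 2 + v.1 * v.2.2.1 - v.1 * v.2.2.2 +
          2 * v.2.1 * v.2.2.1 + v.2.1 * v.2.2.2 = 7} = 48 := by
  rw [natCard_form_eq_card_filter_box 7 6 4 2 3 (by norm_num) (by norm_num) (by norm_num) (by norm_num) (by norm_num) (by norm_num)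
    (by norm_num) (by norm_num)]
  decide +kernel

/-- **`r₅(8) = 90 = 6σ(8)`** (`T(8) = 15 = T(2)T(4) − 2T(2)`). [cite: Eichler1973, Ch. II §6 Thm. 2 (19) and Cor. 1] -/
theorem natCard_form_eight :
    Nat.card {v : ℤ × ℤ × ℤ × ℤ //
        v.1 ^ 2 + 2 * v.2.1 ^ 2 + 2 * v.2.2.1 ^ 2 + v.2.2.2 ^ 2 + v.1 * v.2.2.1 - v.1 * v.2.2.2 +
          2 * v.2.1 * v.2.2.1 + v.2.1 * v.2.2.2 = 8} = 90 := by
  rw [natCard_form_eq_card_filter_box 8 6 4 2 4 (by norm_num) (by norm_num) (by norm_num) (by norm_num) (by norm_num) (by norm_num)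
    (by norm_num) (by norm_num)]
  decide +kernel

/-- The divisor sums behind the six values: `σ(2), σ(3), σ(4), σ(6), σ(7), σ(8) = 3, 4, 7, 12, 8, 15`. [cite: Eichler1973, Ch. II §6 Thm. 2 Cor. 1] -/
theorem sigma_values :
    ArithmeticFunction.sigma 1 2 = 3 ∧ ArithmeticFunction.sigma 1 3 = 4 ∧ ArithmeticFunction.sigma 1 4 = 7 ∧
      ArithmeticFunction.sigma 1 6 = 12 ∧ ArithmeticFunction.sigma 1 7 = 8 ∧ ArithmeticFunction.sigma 1 8 = 15 := by
  refine ⟨?_, ?_, ?_, ?_, ?_, ?_⟩ <;> decide +kernel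

/-- **`#{x ∈ O₅ : nrd x = 2} = 18`.** [cite: Eichler1973, Ch. II §6 Thm. 2 Cor. 1] [cite: Voight2021, Exercise 17.10] -/
theorem natCard_reducedNorm_two : Nat.card {x : ℍ[ℚ,-2,-5] // x ∈ (Submodule.span ℤ (Set.range ![(⟨1, 0, 0, 0⟩ : ℍ[ℚ,-2,-5]), ⟨0, 1, 0, 0⟩, ⟨1/2, 1/2, 1/2, 0⟩, ⟨-1/2, 1/4, 0, 1/4⟩])) ∧ reducedNorm ℚ ℍ[ℚ,-2,-5] x = (2 : ℕ)} = 18 := by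
  have h := natCard_reducedNorm_eq_natCard_form ((2 : ℕ) : ℤ)
  push_cast at h ⊢
  rw [h]
  exact natCard_form_two

/-- **`#{x ∈ O₅ : nrd x = 3} = 24`.** [cite: Eichler1973, Ch. II §6 Thm. 2 Cor. 1] [cite: Voight2021, Exercise 17.10] -/
theorem natCard_reducedNorm_three : Nat.card {x : ℍ[ℚ,-2,-5] // x ∈ (Submodule.span ℤ (Set.range ![(⟨1, 0, 0, 0⟩ : ℍ[ℚ,-2,-5]), ⟨0, 1, 0, 0⟩, ⟨1/2, 1/2, 1/2, 0⟩, ⟨-1/2, 1/4, 0, 1/4⟩])) ∧ reducedNorm ℚ ℍ[ℚ,-2,-5] x = (3 : ℕ)} = 24 := by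
  have h := natCard_reducedNorm_eq_natCard_form ((3 : ℕ) : ℤ)
  push_cast at h ⊢
  rw [h]
  exact natCard_form_three

end Counts

end Literature.NumberTheory.Automorphic.MaxOrderDiscFive
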